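import Summits.HubbardSuperconductivity.HubbardSuperconductivity.Theorems.AnisotropyChordTransferFibre3ManifoldA

/-!
# Route `AnisotropyChord` / H0 rotor rung, row C (KT-2b): the THIRD-SHELL WINDOW values `a_λ(2,1)`, `a_λ(3,0)` for `L ≥ 128`

Companion of `ManifoldA.second_shell_window` (PartN41-A `SecondShellWindow`: `a_λ(1,1)`, `a_λ(2,0)` to `±0.001`).  The six
contact-shell configurations `C0(x̂, b)`, `b ∈ shellWin`, of the KT-2b row (`…Fibre3KT2bRow` §4, `C0ShellForm`) involve the
profile at `|r|∞ ≤ 3`; by the lattice symmetries of the ground profile the only further window values are `a_λ(2,1)` and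
`a_λ(3,0)`.  For `L ≥ 128`, `0 ≤ ν ≤ 0.0513`, `λ = ν(2π/L)²`:
★ `third_shell_window`:  `|a_λ(2,1) − (2/π − 1/4)| ≤ 0.001`,  `|a_λ(3,0) − (17/4 − 12/π)| ≤ 0.003`
(`Subsample.dev_two_one`/`dev_three_zero`: `|a_L(r;0) − a_{ℤ²}(r)| ≤ 3/L², 24/L²`; `aZ2_two_one'`, `aZ2_three_zero'`;
`CapacityConst.lamPart_KT_le`: `0 ≤ δ_λ(r) ≤ ν|r|²(7.76 ln L + 3.3)/L²`; `ln L/L² ≤ 4.8521/16384`).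
Prover seat `hubbard-h0-rotor-p1` g28 (route lead); helper for piece A = stmt-HubbardSuperconductivity-23918 of rung 19089
(`--supports`, helper class).  WHAT THIS IS NOT: nothing here proves superconductivity in the Hubbard model; two window
enclosures for ONE row of ONE conditional reduction; the rotor TARGET as originally worded stays FALSE (g15 verdict).
Tree imports only; no new definitions; no sorry, no new axioms.
-/

set_option linter.dupNamespace false
set_option autoImplicit false

noncomputable section

namespace Summit.HubbardSuperconductivity.HubbardSuperconductivity.Theorems.AnisotropyChord.Transfer.Fibre3

namespace RowC

variable (L : ℕ) [NeZero L]

/-- ★ THIRD-SHELL WINDOW: for `L ≥ 128`, `0 ≤ ν ≤ 0.0513`, `λ = ν(2π/L)²`: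
`|a_λ(2,1) − (2/π − 1/4)| ≤ 0.001` and `|a_λ(3,0) − (17/4 − 12/π)| ≤ 0.003`. [folklore] -/
theorem third_shell_window (hL : 128 ≤ L) (ν : ℝ) (hν0 : 0 ≤ ν) (hν : ν ≤ 0.0513) :
    |aKer L (ν * (2 * Real.pi / L) ^ 2) ((((2 : ℤ)) : ZMod L), (((1 : ℤ)) : ZMod L)) - (2 / Real.pi - 1 / 4)| ≤ 0.001 ∧
    |aKer L (ν * (2 * Real.pi / L) ^ 2) ((((3 : ℤ)) : ZMod L), (((0 : ℤ)) : ZMod L)) - (17 / 4 - 12 / Real.pi)| ≤ 0.003 := by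
  have hL0 : (0 : ℝ) < L := by exact_mod_cast (show 0 < L by omega)
  have hL128 : (128 : ℝ) ≤ L := by exact_mod_cast hL
  have hV : (0 : ℝ) < (L : ℝ) ^ 2 := by positivity
  have hν7 : ν ≤ 0.07 := by linarith
  have hlogq := ManifoldA.log_div_sq_le (L : ℝ) hL128
  have hinv : 1 / (L : ℝ) ^ 2 ≤ 1 / 16384 := one_div_le_one_div_of_le (by norm_num) (by nlinarith)
  have hlog0 : 0 ≤ Real.log L := Real.log_nonneg (by linarith)
  -- λ-parts
  have hl21 := CapacityConst.lamPart_KT_le L (by omega) ν hν0 hν7 2 1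
  have hl30 := CapacityConst.lamPart_KT_le L (by omega) ν hν0 hν7 3 0
  have hε : 0 < eps1 L := RateLemma.eps1_pos_of_two_le L (by omega)
  have hπlo := Real.pi_gt_d6
  have hπhi := Real.pi_lt_d6
  have hlam0 : 0 ≤ ν * (2 * Real.pi / L) ^ 2 := by positivity
  have hlam1 : ν * (2 * Real.pi / L) ^ 2 < 2 * eps1 L := by
    have hεJ : 2 / Real.pi ^ 2 * (2 * Real.pi / L) ^ 2 ≤ eps1 L := RateLemma.eps1_ge_jordan L (by omega)
    have h1 : ν * (2 * Real.pi / L) ^ 2 < 4 / Real.pi ^ 2 * (2 * Real.pi / L) ^ 2 := by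
      apply mul_lt_mul_of_pos_right _ (by positivity)
      rw [lt_div_iff₀ (by positivity)]; nlinarith
    have h2 : 4 / Real.pi ^ 2 * (2 * Real.pi / L) ^ 2 = 2 * (2 / Real.pi ^ 2 * (2 * Real.pi / L) ^ 2) := by ring
    linarith
  have hp21 := (RateLemma.lamPartShellBound_holds L (by omega) _ hlam0 hlam1 ((((2 : ℤ)) : ZMod L), (((1 : ℤ)) : ZMod L))).1
  have hp30 := (RateLemma.lamPartShellBound_holds L (by omega) _ hlam0 hlam1 ((((3 : ℤ)) : ZMod L), (((0 : ℤ)) : ZMod L))).1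
  -- λ = 0 deviations
  have hd21 := Subsample.dev_two_one L (by omega)
  have hd30 := Subsample.dev_three_zero L (by omega)
  rw [Subsample.aZ2_two_one'] at hd21
  rw [Subsample.aZ2_three_zero'] at hd30
  obtain ⟨hd21a, hd21b⟩ := abs_le.mp hd21
  obtain ⟨hd30a, hd30b⟩ := abs_le.mp hd30
  -- numeric sizes
  have hsz : (7.76 * Real.log L + 3.3) / (L : ℝ) ^ 2 ≤ 0.0025 := by
    have e : (7.76 * Real.log L + 3.3) / (L : ℝ) ^ 2 = 7.76 * (Real.log L / (L : ℝ) ^ 2) + 3.3 * (1 / (L : ℝ) ^ 2) := by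
      field_simp
    rw [e]; nlinarith
  have hl21' : RateLemma.lamPart L (ν * (2 * Real.pi / L) ^ 2) ((((2 : ℤ)) : ZMod L), (((1 : ℤ)) : ZMod L)) ≤ 0.00065 := by
    refine hl21.trans ?_
    push_cast
    have e : ν * ((2 : ℝ) ^ 2 + (1 : ℝ) ^ 2) * (7.76 * Real.log L + 3.3) / (L : ℝ) ^ 2
        = 5 * ν * ((7.76 * Real.log L + 3.3) / (L : ℝ) ^ 2) := by ring
    rw [e]
    have h0 : 0 ≤ (7.76 * Real.log L + 3.3) / (L : ℝ) ^ 2 := by positivity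
    have := mul_le_mul hν hsz h0 (by norm_num)
    linarith
  have hl30' : RateLemma.lamPart L (ν * (2 * Real.pi / L) ^ 2) ((((3 : ℤ)) : ZMod L), (((0 : ℤ)) : ZMod L)) ≤ 0.0012 := by
    refine hl30.trans ?_
    push_cast
    have e : ν * ((3 : ℝ) ^ 2 + (0 : ℝ) ^ 2) * (7.76 * Real.log L + 3.3) / (L : ℝ) ^ 2
        = 9 * ν * ((7.76 * Real.log L + 3.3) / (L : ℝ) ^ 2) := by ring
    rw [e]
    have h0 : 0 ≤ (7.76 * Real.log L + 3.3) / (L : ℝ) ^ 2 := by positivity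
    have := mul_le_mul hν hsz h0 (by norm_num)
    linarith
  have e21 : aKer L (ν * (2 * Real.pi / L) ^ 2) ((((2 : ℤ)) : ZMod L), (((1 : ℤ)) : ZMod L))
      = aKer L 0 ((((2 : ℤ)) : ZMod L), (((1 : ℤ)) : ZMod L))
        + RateLemma.lamPart L (ν * (2 * Real.pi / L) ^ 2) ((((2 : ℤ)) : ZMod L), (((1 : ℤ)) : ZMod L)) := by
    unfold RateLemma.lamPart; ring
  have e30 : aKer L (ν * (2 * Real.pi / L) ^ 2) ((((3 : ℤ)) : ZMod L), (((0 : ℤ)) : ZMod L))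
      = aKer L 0 ((((3 : ℤ)) : ZMod L), (((0 : ℤ)) : ZMod L))
        + RateLemma.lamPart L (ν * (2 * Real.pi / L) ^ 2) ((((3 : ℤ)) : ZMod L), (((0 : ℤ)) : ZMod L)) := by
    unfold RateLemma.lamPart; ring
  have h3 : 3 / (L : ℝ) ^ 2 ≤ 3 / 16384 := by
    apply div_le_div_of_nonneg_left (by norm_num) (by norm_num) (by nlinarith)
  have h24 : 24 / (L : ℝ) ^ 2 ≤ 24 / 16384 := by
    apply div_le_div_of_nonneg_left (by norm_num) (by norm_num) (by nlinarith)
  constructor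
  · rw [e21, abs_le]; constructor <;> linarith only [hd21a, hd21b, hp21, hl21', h3]
  · rw [e30, abs_le]; constructor <;> linarith only [hd30a, hd30b, hp30, hl30', h24]

end RowC

end Summit.HubbardSuperconductivity.HubbardSuperconductivity.Theorems.AnisotropyChord.Transfer.Fibre3

end
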